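import Summits.Schanuel.Schanuel.Theorems.RootDecomp1ETwoScale07
import Summits.Schanuel.Schanuel.Theses.RootDecomp1E
import Summits.Schanuel.Schanuel.Theorems.RootDecomp1EPointTransfer03
import Summits.Schanuel.Schanuel.Theorems.RootDecomp1EScaleTransfer03

/-!
# RootDecomp1ETwoScale — lens 2, generation 37 «TWO-SCALE E-PLANES» (items 25020 / 31409 of route 1E at n = 4 on `InTwoScaleClass`, mod NW96 Thm 1) — continuation (RootDecomp1ETwoScale08): §5 the cells against the LIVE items of route 1E at n := 4 (`defectOneSchanuel_twoScaleCell`, `eStableDefectOne_twoScaleCell`, positional links `…_of_item`), the members `zTS = (T₀, iT₀, σ₀, iσ₀)` with hypothesis-free certificates, items APPLIED / instances mod hNW, separation from `InPointClass` / `OnHyperLine` / `InScaleClass` — the ONLY part importing `Theses.RootDecomp1E`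

(lens-2 g37 `TwoScale.lean` v2 [HOME/decomp-schanuel-lens-2/g37/TwoScale.lean v2 sha256 e81e28b8…d084, 2853 l (v1 df3b5e32…, 2509 l + §5b); own farm rc 0 · 0 warn · 0 sorry · axioms std; critic VERDICT STATUS L1776 (credit E-R17, PORT GO), v2 ACK L1780]; port by census-1 gen 16 in nine parts
`RootDecomp1ETwoScale01`–`09` — see the PORT NOTE of part 01; `--supports stmt-Schanuel-31409`; rung 0.)
-/

noncomputable section

open Complex Polynomial IntermediateField Filter

namespace Summit.Schanuel.Schanuel.Theorems.RootDecomp1ETwoScale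

open Summit.Schanuel.Schanuel.Theorems.RootDecomp1KHyper
open Summit.Schanuel.Schanuel.Theorems.RootDecomp1KHyper.HyperCell
open Summit.Schanuel.Schanuel.Theorems.RootDecomp1KGeneric
open Literature.NumberTheory.Transcendental (NesterenkoWaldschmidt1996_thm_1 weilHeight₁)

variable {K : ℕ}

section Cells

open Summit.Schanuel.Schanuel.Theorems.RootDecomp1EPointTransfer (InPointClass OnHyperLine)
open Summit.Schanuel.Schanuel.Theorems.RootDecomp1EScaleTransfer (InScaleClass HyperScaleApprox)

/-- `k` algebraically independent members of an intermediate field give `trdeg ≥ k`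
(the three-line `RootDecomp1ELevels.le_trdeg_of_algebraicIndependent`, re-proved to keep the import cone small). -/
private theorem le_trdeg_of_algInd {L : IntermediateField ℚ ℂ} {k : ℕ} {v : Fin k → ℂ}
    (hv : AlgebraicIndependent ℚ v) (hmem : ∀ i, v i ∈ L) :
    (k : Cardinal) ≤ Algebra.trdeg ℚ ↥L := by
  let y : Fin k → ↥L := fun i => ⟨v i, hmem i⟩
  have hy : AlgebraicIndependent ℚ y := AlgebraicIndependent.of_comp L.val hv
  simpa using hy.cardinalMk_le_trdeg

/-- `3 ≤ t ⟹ 4 ≤ t + 1` in `Cardinal`. -/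
private theorem four_le_add_one {t : Cardinal} (h : ((3 : ℕ) : Cardinal) ≤ t) :
    ((4 : ℕ) : Cardinal) ≤ t + 1 := by
  have e : ((4 : ℕ) : Cardinal) = ((3 : ℕ) : Cardinal) + 1 := by
    rw [show (4 : ℕ) = 3 + 1 from rfl, Nat.cast_succ]
  rw [e]
  exact add_le_add h le_rfl

/-- **`InTwoScaleClass z` — THE CELL LINE.** The two-scale E-plane `z = (T, βT, σ, βσ)`: `T ≠ 0` a COVERED
log-quartic tower (`CoveredTower T`: for every large `X` a rational `r`, `X ≤ den r ≤ X^{4 log³ X}`, with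
`|T − r| ≤ exp(−log³ den r)`), `σ` a real of the log-power Liouville class `LogPowLiouville 19`
(`|σ − r| < den(r)^{−m·log¹⁸ den r}` for every `m`) — a SECOND transcendental scale, algebraically independent
of `T` — and `β` an irrational algebraic multiplier (the plane is a line over the number field `E = ℚ(β)`,
i.e. E-stable in the sense of item 31409). Non-homogeneous: no single scale `ξ` with `z ∈ ξ·ℚ̄⁴`. -/
def InTwoScaleClass (z : Fin 4 → ℂ) : Prop :=
  ∃ (T σ : ℝ) (β : ℂ), CoveredTower T ∧ T ≠ 0 ∧ LogPowLiouville 19 σ ∧ IsAlgebraic ℚ β ∧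
    β ∉ Set.range (algebraMap ℚ ℂ) ∧ z = ![(T : ℂ), β * T, (σ : ℂ), β * σ]

/-- Read-out of the class (by `Iff.rfl`). -/
theorem inTwoScaleClass_iff (z : Fin 4 → ℂ) : InTwoScaleClass z ↔
    ∃ (T σ : ℝ) (β : ℂ), CoveredTower T ∧ T ≠ 0 ∧ LogPowLiouville 19 σ ∧ IsAlgebraic ℚ β ∧
      β ∉ Set.range (algebraMap ℚ ℂ) ∧ z = ![(T : ℂ), β * T, (σ : ℂ), β * σ] := Iff.rfl

/-- Read-out of the scale class: `LogPowLiouville p σ` unfolded (by `Iff.rfl`). -/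
theorem logPowLiouville_iff (p : ℕ) (σ : ℝ) : LogPowLiouville p σ ↔
    ∀ m : ℕ, ∃ r : ℚ, m ≤ r.den ∧ σ ≠ r ∧ |σ - r| < Real.exp (-((m : ℝ) * Real.log r.den ^ p)) := Iff.rfl

/-- Read-out of the tower class: `CoveredTower T` unfolded (by `Iff.rfl`). -/
theorem coveredTower_iff (T : ℝ) : CoveredTower T ↔
    ∃ N₀ : ℕ, ∀ X : ℕ, N₀ ≤ X → ∃ r : ℚ, X ≤ r.den ∧ Real.log r.den ≤ 4 * Real.log X ^ 4 ∧
      |T - r| ≤ Real.exp (-(Real.log r.den ^ 3)) := Iff.rfl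

/-- **THREE algebraically independent numbers inside `ℚ(z, e^z)` on the class** (mod NW96 Thm 1): `σ, T, e^T`
(`algebraicIndependent_two_scale`). -/
theorem three_le_trdeg_of_inTwoScaleClass (hNW : NesterenkoWaldschmidt1996_thm_1) (z : Fin 4 → ℂ)
    (hcls : InTwoScaleClass z) :
    ((3 : ℕ) : Cardinal) ≤ Algebra.trdeg ℚ
      ↥(IntermediateField.adjoin ℚ (Set.range z ∪ Set.range (Complex.exp ∘ z))) := by
  obtain ⟨T, σ, β, hT, hT0, hσ, -, -, rfl⟩ := hcls
  refine le_trdeg_of_algInd (algebraicIndependent_two_scale hNW hT hT0 hσ) fun i => ?_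
  apply IntermediateField.subset_adjoin
  fin_cases i
  · exact Or.inl ⟨2, by simp⟩
  · exact Or.inl ⟨0, by simp⟩
  · exact Or.inr ⟨0, by simp⟩

/-- **CELL of item 25020 `DefectOneSchanuel` (S⁻) at its length `n = 4`** — the item's binders at `n := 4`,
`InTwoScaleClass z` inserted after `LinearIndependent ℚ z`; conclusion EXACTLY the item's
`((4 : ℕ) : Cardinal) ≤ trdeg ℚ(z, e^z) + 1` (mod NW96 Thm 1). `SB 4 z` (S itself: `trdeg ≥ 4`) is NOT
obtained — the fourth exponential coordinate stays dark. -/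
theorem defectOneSchanuel_twoScaleCell (hNW : NesterenkoWaldschmidt1996_thm_1) :
    ∀ (z : Fin 4 → ℂ), LinearIndependent ℚ z → InTwoScaleClass z →
      ((4 : ℕ) : Cardinal) ≤ Algebra.trdeg ℚ
        ↥(IntermediateField.adjoin ℚ (Set.range z ∪ Set.range (Complex.exp ∘ z))) + 1 :=
  fun z _ hcls => four_le_add_one (three_le_trdeg_of_inTwoScaleClass hNW z hcls)

/-- **CELL of item 31409 `EStableDefectOne` at its FIRST OPEN LENGTH `n = 4`** — binders verbatim at `n := 4`
(the E-stability binder and the first-failure/induction binder carried, unused), `InTwoScaleClass z` inserted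
after `LinearIndependent ℚ z`; conclusion EXACTLY the item's (mod NW96 Thm 1). `SB 4 z` NOT obtained. -/
theorem eStableDefectOne_twoScaleCell (hNW : NesterenkoWaldschmidt1996_thm_1) :
    ∀ (z : Fin 4 → ℂ), LinearIndependent ℚ z → InTwoScaleClass z →
      (∃ β : ℂ, IsAlgebraic ℚ β ∧ β ∉ Set.range (algebraMap ℚ ℂ) ∧
        ∀ i, β * z i ∈ Submodule.span ℚ (Set.range z)) →
      (∀ (m : ℕ) (w : Fin m → ℂ), m < 4 → LinearIndependent ℚ w →
        (∀ j, w j ∈ Submodule.span ℚ (Set.range z)) →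
        (m : Cardinal) ≤ Algebra.trdeg ℚ ↥(IntermediateField.adjoin ℚ
          (Set.range w ∪ Set.range (Complex.exp ∘ w))) + 1) →
      ((4 : ℕ) : Cardinal) ≤ Algebra.trdeg ℚ ↥(IntermediateField.adjoin ℚ
        (Set.range z ∪ Set.range (Complex.exp ∘ z))) + 1 :=
  fun z _ hcls _ _ => four_le_add_one (three_le_trdeg_of_inTwoScaleClass hNW z hcls)

/-- **LINK: the 31409 cell statement IS the live item restricted** — positional application of the route decl
`Summit.Schanuel.Schanuel.Theses.RootDecomp1E.EStableDefectOne` at `n := 4` (class hypothesis discarded). -/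
theorem eStableDefectOne_twoScaleCell_of_item
    (h31409 : Summit.Schanuel.Schanuel.Theses.RootDecomp1E.EStableDefectOne) :
    ∀ (z : Fin 4 → ℂ), LinearIndependent ℚ z → InTwoScaleClass z →
      (∃ β : ℂ, IsAlgebraic ℚ β ∧ β ∉ Set.range (algebraMap ℚ ℂ) ∧
        ∀ i, β * z i ∈ Submodule.span ℚ (Set.range z)) →
      (∀ (m : ℕ) (w : Fin m → ℂ), m < 4 → LinearIndependent ℚ w →
        (∀ j, w j ∈ Submodule.span ℚ (Set.range z)) →
        (m : Cardinal) ≤ Algebra.trdeg ℚ ↥(IntermediateField.adjoin ℚ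
          (Set.range w ∪ Set.range (Complex.exp ∘ w))) + 1) →
      ((4 : ℕ) : Cardinal) ≤ Algebra.trdeg ℚ ↥(IntermediateField.adjoin ℚ
        (Set.range z ∪ Set.range (Complex.exp ∘ z))) + 1 := by
  intro z hz _ hE hIH
  exact h31409 4 z hz hE hIH

/-- **LINK for 25020**: positional application of `…Theses.RootDecomp1E.DefectOneSchanuel` at `n := 4`. -/
theorem defectOneSchanuel_twoScaleCell_of_item
    (h25020 : Summit.Schanuel.Schanuel.Theses.RootDecomp1E.DefectOneSchanuel) :
    ∀ (z : Fin 4 → ℂ), LinearIndependent ℚ z → InTwoScaleClass z →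
      ((4 : ℕ) : Cardinal) ≤ Algebra.trdeg ℚ
        ↥(IntermediateField.adjoin ℚ (Set.range z ∪ Set.range (Complex.exp ∘ z))) + 1 := by
  intro z hz _
  exact h25020 4 z hz

/-! ### The members: the two-scale Gaussian plane `z_TS = (T₀, iT₀, σ₀, iσ₀)` -/

/-- The anchor `T₀ = Σ_k 2^{-2^{4^k}}` — a covered log-quartic tower. -/
def T₀ : ℝ := ptower 4

/-- The second scale `σ₀ = Σ_k 2^{-2^{20^k}}` — of class `LogPowLiouville 19`. -/
def σ₀ : ℝ := ptower 20

/-- **THE MEMBER** `z_TS = (T₀, iT₀, σ₀, iσ₀)` (`β = i`, `E = ℚ(i)`): a two-scale Gaussian plane — compare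
item 31409's own «why it might fail» witness shape, the Gaussian plane `(1, i, π, iπ)`. -/
def zTS : Fin 4 → ℂ := ![(T₀ : ℂ), I * T₀, (σ₀ : ℂ), I * σ₀]

/-- `T₀` is a covered tower (hypothesis-free certificate `coveredTower_ptower_four`). -/
theorem coveredTower_T₀ : CoveredTower T₀ := coveredTower_ptower_four

/-- `T₀ ≠ 0`. -/
theorem T₀_ne_zero : T₀ ≠ 0 := (ptower_pos (by norm_num)).ne'

/-- `σ₀ ≠ 0`. -/
theorem σ₀_ne_zero : σ₀ ≠ 0 := (ptower_pos (by norm_num)).ne'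

/-- `σ₀` lies in the scale class `LogPowLiouville 19` (hypothesis-free certificate). -/
theorem logPowLiouville_σ₀ : LogPowLiouville 19 σ₀ := logPowLiouville_ptower (by norm_num) (by norm_num)

/-- SEPARATION DATA (order): `T₀` is not even Liouville of order 1 in the `q^{-m}`-for-every-`m`… sense of
`LiouvilleOrder 1` (lens 1 / lens 6 scales are of every or of a fixed finite EXPONENTIAL order). -/
theorem not_liouvilleOrder_one_T₀ : ¬ LiouvilleOrder 1 T₀ := not_liouvilleOrder_one_ptower (by norm_num)

/-- … nor is `σ₀`. -/
theorem not_liouvilleOrder_one_σ₀ : ¬ LiouvilleOrder 1 σ₀ := not_liouvilleOrder_one_ptower (by norm_num)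

/-- `T₀` is not hyper-Liouville (g36's point-class scale type). -/
theorem not_hyperLiouville_T₀ : ¬ HyperLiouville T₀ := not_hyperLiouville_ptower (by norm_num)

/-- `σ₀` is not hyper-Liouville. -/
theorem not_hyperLiouville_σ₀ : ¬ HyperLiouville σ₀ := not_hyperLiouville_ptower (by norm_num)

/-- `i` is algebraic (`X² + 1`). -/
private theorem isAlgebraic_I' : IsAlgebraic ℚ I :=
  ⟨X ^ 2 + 1, (Polynomial.monic_X_pow_add_C (1 : ℚ) two_ne_zero).ne_zero, by simp⟩

/-- `i ∉ ℚ`. -/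
private theorem I_not_rat : I ∉ Set.range (algebraMap ℚ ℂ) := by
  rintro ⟨q, hq⟩
  have h := congrArg Complex.im hq
  simp at h

/-- A rational number is algebraic (as an element of `ℂ`). -/
private theorem ratCast_mem_acl (q : ℚ) : (q : ℂ) ∈ algebraicClosure ℚ ℂ :=
  (algebraicClosure ℚ ℂ).algebraMap_mem q

/-- `i` lies in the algebraic closure of `ℚ` in `ℂ`. -/
private theorem I_mem_acl : I ∈ algebraicClosure ℚ ℂ := mem_algebraicClosure_iff.mpr isAlgebraic_I'

/-- **Class certificate of the member** (hypothesis-free). -/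
theorem zTS_inTwoScaleClass : InTwoScaleClass zTS :=
  ⟨T₀, σ₀, I, coveredTower_T₀, T₀_ne_zero, logPowLiouville_σ₀, isAlgebraic_I', I_not_rat, rfl⟩

/-- **`(T₀, σ₀)` is algebraically independent over ℚ — HYPOTHESIS-FREE** (the level-0 kernel: the constant-term
measure of the covered tower uses no literature fact). -/
theorem algebraicIndependent_T₀σ₀ : AlgebraicIndependent ℚ ![(T₀ : ℂ), (σ₀ : ℂ)] :=
  algebraicIndependent_tower_sigma coveredTower_T₀ T₀_ne_zero logPowLiouville_σ₀

/-- **`(T₀, σ₀)` is linearly independent over the field `ℚ̄ ∩ ℂ` of ALL algebraic numbers** (hypothesis-free: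
Mathlib's `AlgebraicIndependent.algebraicClosure` + `.linearIndependent`). This single fact yields the member's
ℚ-linear independence AND its separation from every homogeneous class `ξ · ℚ̄ⁿ`. -/
theorem linearIndependent_T₀σ₀_acl :
    LinearIndependent (↥(algebraicClosure ℚ ℂ)) ![(T₀ : ℂ), (σ₀ : ℂ)] :=
  algebraicIndependent_T₀σ₀.algebraicClosure.linearIndependent

/-- No relation `a·T₀ + b·σ₀ = 0` with algebraic `a, b`, unless `a = b = 0`. -/
theorem T₀σ₀_free {a b : ℂ} (ha : a ∈ algebraicClosure ℚ ℂ) (hb : b ∈ algebraicClosure ℚ ℂ)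
    (h : a * T₀ + b * σ₀ = 0) : a = 0 ∧ b = 0 := by
  have hLI := linearIndependent_T₀σ₀_acl
  rw [LinearIndependent.pair_iff] at hLI
  obtain ⟨hs, ht⟩ := hLI ⟨a, ha⟩ ⟨b, hb⟩ h
  exact ⟨congrArg Subtype.val hs, congrArg Subtype.val ht⟩

/-- **`z_TS` is ℚ-linearly independent** (hypothesis-free). -/
theorem zTS_linearIndependent : LinearIndependent ℚ zTS := by
  rw [Fintype.linearIndependent_iff]
  intro g hg
  rw [Fin.sum_univ_four] at hg
  simp only [Rat.smul_def] at hg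
  have e0 : zTS 0 = T₀ := rfl
  have e1 : zTS 1 = I * T₀ := rfl
  have e2 : zTS 2 = σ₀ := rfl
  have e3 : zTS 3 = I * σ₀ := rfl
  rw [e0, e1, e2, e3] at hg
  have hrel : ((g 0 : ℂ) + g 1 * I) * T₀ + ((g 2 : ℂ) + g 3 * I) * σ₀ = 0 := by
    linear_combination hg
  have ha : (g 0 : ℂ) + g 1 * I ∈ algebraicClosure ℚ ℂ :=
    add_mem (ratCast_mem_acl _) (mul_mem (ratCast_mem_acl _) I_mem_acl)
  have hb : (g 2 : ℂ) + g 3 * I ∈ algebraicClosure ℚ ℂ :=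
    add_mem (ratCast_mem_acl _) (mul_mem (ratCast_mem_acl _) I_mem_acl)
  obtain ⟨hs, ht⟩ := T₀σ₀_free ha hb hrel
  have h0 := congrArg Complex.re hs
  have h1 := congrArg Complex.im hs
  have h2 := congrArg Complex.re ht
  have h3 := congrArg Complex.im ht
  simp at h0 h1 h2 h3
  intro i
  fin_cases i
  · exact h0
  · exact h1
  · exact h2
  · exact h3

/-- **E-stability certificate of `z_TS`** (`β = i`): `i · z_TS ⊂ span_ℚ z_TS`. -/
theorem zTS_eStable : ∃ β : ℂ, IsAlgebraic ℚ β ∧ β ∉ Set.range (algebraMap ℚ ℂ) ∧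
    ∀ i, β * zTS i ∈ Submodule.span ℚ (Set.range zTS) := by
  refine ⟨I, isAlgebraic_I', I_not_rat, fun i => ?_⟩
  have mem : ∀ j, zTS j ∈ Submodule.span ℚ (Set.range zTS) :=
    fun j => Submodule.subset_span ⟨j, rfl⟩
  have e0 : zTS 0 = T₀ := rfl
  have e1 : zTS 1 = I * T₀ := rfl
  have e2 : zTS 2 = σ₀ := rfl
  have e3 : zTS 3 = I * σ₀ := rfl
  fin_cases i
  · show I * zTS 0 ∈ _
    rw [e0, ← e1]; exact mem 1
  · show I * zTS 1 ∈ _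
    have e : I * zTS 1 = (-1 : ℚ) • zTS 0 := by
      rw [e1, e0, Rat.smul_def, ← mul_assoc, Complex.I_mul_I]; push_cast; ring
    rw [e]; exact Submodule.smul_mem _ _ (mem 0)
  · show I * zTS 2 ∈ _
    rw [e2, ← e3]; exact mem 3
  · show I * zTS 3 ∈ _
    have e : I * zTS 3 = (-1 : ℚ) • zTS 2 := by
      rw [e3, e2, Rat.smul_def, ← mul_assoc, Complex.I_mul_I]; push_cast; ring
    rw [e]; exact Submodule.smul_mem _ _ (mem 2)

/-! ### The live items APPLIED at the member, and the cell DISCHARGING the same instances (mod NW96 Thm 1) -/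

/-- **Item 31409 `EStableDefectOne` APPLIED to the member** — `zTS_linearIndependent`, `zTS_eStable` ARE the
item's scope hypotheses at `z := zTS`, `n := 4`; the first-failure (induction) binder is CARRIED as `hIH`. -/
theorem item31409_applied_at_zTS (h31409 : Summit.Schanuel.Schanuel.Theses.RootDecomp1E.EStableDefectOne)
    (hIH : ∀ (m : ℕ) (w : Fin m → ℂ), m < 4 → LinearIndependent ℚ w →
        (∀ j, w j ∈ Submodule.span ℚ (Set.range zTS)) →
        (m : Cardinal) ≤ Algebra.trdeg ℚ ↥(IntermediateField.adjoin ℚ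
          (Set.range w ∪ Set.range (Complex.exp ∘ w))) + 1) :
    ((4 : ℕ) : Cardinal) ≤ Algebra.trdeg ℚ ↥(IntermediateField.adjoin ℚ
        (Set.range zTS ∪ Set.range (Complex.exp ∘ zTS))) + 1 :=
  h31409 4 zTS zTS_linearIndependent zTS_eStable hIH

/-- … and the cell theorem DISCHARGES the same instance (mod NW96 Thm 1; `hIH` carried, unused). -/
theorem item31409_instance_at_zTS (hNW : NesterenkoWaldschmidt1996_thm_1)
    (hIH : ∀ (m : ℕ) (w : Fin m → ℂ), m < 4 → LinearIndependent ℚ w →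
        (∀ j, w j ∈ Submodule.span ℚ (Set.range zTS)) →
        (m : Cardinal) ≤ Algebra.trdeg ℚ ↥(IntermediateField.adjoin ℚ
          (Set.range w ∪ Set.range (Complex.exp ∘ w))) + 1) :
    ((4 : ℕ) : Cardinal) ≤ Algebra.trdeg ℚ ↥(IntermediateField.adjoin ℚ
        (Set.range zTS ∪ Set.range (Complex.exp ∘ zTS))) + 1 :=
  eStableDefectOne_twoScaleCell hNW zTS zTS_linearIndependent zTS_inTwoScaleClass zTS_eStable hIH

/-- **Item 25020 `DefectOneSchanuel` (S⁻) APPLIED to the member** (`n := 4`). -/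
theorem item25020_applied_at_zTS (h25020 : Summit.Schanuel.Schanuel.Theses.RootDecomp1E.DefectOneSchanuel) :
    ((4 : ℕ) : Cardinal) ≤ Algebra.trdeg ℚ ↥(IntermediateField.adjoin ℚ
        (Set.range zTS ∪ Set.range (Complex.exp ∘ zTS))) + 1 :=
  h25020 4 zTS zTS_linearIndependent

/-- **… DISCHARGED by the cell, IH-free** (mod NW96 Thm 1 ONLY): `4 ≤ trdeg ℚ(z_TS, e^{z_TS}) + 1`, i.e.
`trdeg ℚ(T₀, σ₀, e^{T₀}, e^{iT₀}, e^{σ₀}, e^{iσ₀}) ≥ 3` — the S⁻ instance of the route's parent crux at a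
NON-homogeneous quadruple none of whose coordinates is Liouville. -/
theorem item25020_instance_at_zTS (hNW : NesterenkoWaldschmidt1996_thm_1) :
    ((4 : ℕ) : Cardinal) ≤ Algebra.trdeg ℚ ↥(IntermediateField.adjoin ℚ
        (Set.range zTS ∪ Set.range (Complex.exp ∘ zTS))) + 1 :=
  defectOneSchanuel_twoScaleCell hNW zTS zTS_linearIndependent zTS_inTwoScaleClass

/-! ### Separation from the decided classes of g36 (`InPointClass`, `OnHyperLine`) and g35 (`InScaleClass`) —
HYPOTHESIS-FREE: a homogeneous tuple `ξ · y`, `y ∈ ℚ̄ⁿ`, has all coordinate RATIOS algebraic, while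
`T₀/σ₀ ∉ ℚ̄` by `linearIndependent_T₀σ₀_acl`. -/

/-- If `z_TS = ξ · y` coordinatewise with `y 0, y 2` algebraic then `False`. -/
private theorem not_homogeneous {ξ : ℂ} {y : Fin 4 → ℂ} (hy0 : y 0 ∈ algebraicClosure ℚ ℂ)
    (hy2 : y 2 ∈ algebraicClosure ℚ ℂ) (hz : zTS = fun j => ξ * y j) : False := by
  have h0 : (T₀ : ℂ) = ξ * y 0 := congrFun hz 0
  have h2 : (σ₀ : ℂ) = ξ * y 2 := congrFun hz 2
  have hrel : y 2 * T₀ + (-y 0) * σ₀ = 0 := by rw [h0, h2]; ring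
  obtain ⟨-, hy⟩ := T₀σ₀_free hy2 (neg_mem hy0) hrel
  have : (T₀ : ℂ) = 0 := by rw [h0, neg_eq_zero.mp hy, mul_zero]
  exact T₀_ne_zero (by exact_mod_cast this)

/-- **`z_TS` is NOT in g36's point class** `InPointClass` (tree `RootDecomp1EPointTransfer03`). -/
theorem zTS_not_inPointClass : ¬ InPointClass zTS := by
  rintro ⟨ρ, y, -, hyalg, -, hz⟩
  exact not_homogeneous (mem_algebraicClosure_iff.mpr (hyalg 0)) (mem_algebraicClosure_iff.mpr (hyalg 2)) hz

/-- **`z_TS` is NOT on any hyper-rational line** `OnHyperLine` (g36's engine class). -/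
theorem zTS_not_onHyperLine : ¬ OnHyperLine zTS := by
  rintro ⟨y, ξ, hyalg, -, -, hz⟩
  exact not_homogeneous (mem_algebraicClosure_iff.mpr (hyalg 0)) (mem_algebraicClosure_iff.mpr (hyalg 2)) hz

/-- **`z_TS` is NOT in g35's scale class** `InScaleClass` (tree `RootDecomp1EScaleTransfer03`): there the
tuple is `ξ · y` with `γ · y ∈ ℤ-span(ω)`, `ω ∈ ℚ̄^D`, `γ ≠ 0`, so `z = (ξ/γ)·(γy)` is again homogeneous over `ℚ̄`. -/
theorem zTS_not_inScaleClass : ¬ InScaleClass zTS := by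
  rintro ⟨D, ω, y, ξ, hω, -, happ, hz⟩
  obtain ⟨γ, M, hγ, hM, -⟩ := happ 0
  have hmem : ∀ j, γ * y j ∈ algebraicClosure ℚ ℂ := fun j => by
    rw [hM j]
    exact sum_mem fun i _ => mul_mem (intCast_mem _ _) (mem_algebraicClosure_iff.mpr (hω i))
  have hz' : zTS = fun j => (ξ / γ) * (γ * y j) := by
    rw [hz]; funext j; field_simp
  exact not_homogeneous (hmem 0) (hmem 2) hz'

end Cells

end Summit.Schanuel.Schanuel.Theorems.RootDecomp1ETwoScale
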